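import Mathlib.MeasureTheory.Function.LpSeminorm.ChebyshevMarkov
import Mathlib.MeasureTheory.Measure.Lebesgue.EqHaar
import HarnessLib

/-!
# Weak `L^p` (Marcinkiewicz / Lorentz `L^{p,∞}`) membership

Analysis/FunctionSpaces definition file. The **weak Lebesgue space** `L^p_w(μ) = L^{p,∞}(μ)`
consists of the (a.e.-strongly) measurable `f` whose distribution function
`d_f(t) = μ {x : |f(x)| > t}` satisfies `sup_{t>0} t · d_f(t)^{1/p} < ∞`, equivalently
`sup_{t>0} t^p · d_f(t) < ∞` (Grafakos, *Classical Fourier Analysis*, 3rd ed., Def. 1.1.5 with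
Def. 1.1.1; Bradshaw–Tsai, Ann. Henri Poincaré 18 (2017), §1: "`L³_w(ℝ³)` is the weak Lebesgue
space which is equivalent to the Lorentz space `L^{(q,r)}(ℝ³)` with `(q,r) = (3,∞)`"). It is the
space of initial data of the forward discretely self-similar Navier–Stokes solutions of
Bradshaw–Tsai 2017 (Thm. 1.2: `v₀ ∈ L³_w(ℝ³)`), and of the approximating data in Bradshaw–Tsai
2019 (Lemma 4.1); the model member of `L³_w(ℝ³) ∖ L³(ℝ³)` is `|x|⁻¹`.

This file defines
* `eWeakLpPow f p μ = ⨆_{t ≥ 0} t^p · μ {x | t < ‖f x‖}` — the `p`-th power of the weak-`L^p`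
  quasinorm, valued in `ℝ≥0∞` (exponent `p : ℝ≥0∞` entering through `p.toReal`, as in
  `MeasureTheory.eLpNorm`; junk for `p ∈ {0, ∞}`, where `t^0 = 1`);
* `MemWeakLp f p μ` — `f ∈ L^{p,∞}(μ)`: a.e.-strongly measurable with `eWeakLpPow f p μ < ∞`;
and proves the API: Chebyshev's inequality `eWeakLpPow f p μ ≤ ‖f‖_{L^p}^p`
(`eWeakLpPow_le_eLpNorm_rpow`, from Mathlib's `MeasureTheory.mul_meas_ge_le_pow_eLpNorm'`), hence
`L^p ⊆ L^{p,∞}` (`memWeakLp_of_memLp`); `0 ∈ L^{p,∞}`; and **non-vacuity beyond `L^p`**: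
`x ↦ ‖x‖⁻¹` lies in `L^{d,∞}` of a `d`-dimensional real normed space with an additive Haar
measure, `d ≥ 1` (`memWeakLp_inv_norm`; Grafakos, Example 1.1.7 with `p = d`:
`μ{‖x‖⁻¹ > t} = μ(B_{1/t}) = t^{-d} μ(B₁)`).

## Mathlib / tree search

Mathlib has the strong spaces (`MeasureTheory.eLpNorm`, `MeasureTheory.MemLp`) and the
Chebyshev–Markov inequality in `L^p` form (`MeasureTheory.mul_meas_ge_le_pow_eLpNorm'`), but no
weak-`L^p` / Lorentz spaces (searched `weakLp|wnorm|Lorentz|Marcinkiewicz|distribution` in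
`Mathlib/MeasureTheory/Function`); the tree had none either (`lean search 'WeakL|L3w|Lorentz'`:
only the Lorentz *gas* and Lorentz *group*).

## References

* L. Grafakos, *Classical Fourier Analysis*, 3rd ed., GTM 249, Springer 2014, §1.1.1:
  Def. 1.1.1 (distribution function), Def. 1.1.5 (weak `L^p`), Prop. 1.1.6 (`L^p ⊆ L^{p,∞}`,
  Chebyshev), Example 1.1.7 (`|x|^{-n/p} ∈ L^{p,∞}(ℝⁿ) ∖ L^p`).
* Z. Bradshaw, T.-P. Tsai, *Forward discretely self-similar solutions of the Navier–Stokes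
  equations II*, Ann. Henri Poincaré 18 (2017) 1095–1119, §1 [BradshawTsai2017AHP].
-/

noncomputable section

open MeasureTheory TopologicalSpace Set Function Filter Metric Module
open scoped ENNReal NNReal Topology

namespace Literature.Analysis.FunctionSpaces

section General

variable {α : Type*} [MeasurableSpace α] {E : Type*} [NormedAddCommGroup E]

/-- The `p`-th power of the **weak-`L^p` quasinorm**:
`eWeakLpPow f p μ = sup_{t ≥ 0} t^p · μ {x | t < ‖f x‖}` (`= sup_{t>0} t^p d_f(t)` with the
distribution function `d_f(t) = μ{|f| > t}`; Grafakos, Def. 1.1.1 and Def. 1.1.5, where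
`‖f‖_{L^{p,∞}} = sup_{t>0} t d_f(t)^{1/p}`). The exponent enters through `p.toReal` as in
`MeasureTheory.eLpNorm`; for `p = 0` or `p = ∞` the value is the junk `sup_t μ{t < ‖f‖}`. [cite: BradshawTsai2017AHP, §1 (L^3_w = L^{(3,∞)})] -/
def eWeakLpPow (f : α → E) (p : ℝ≥0∞) (μ : Measure α) : ℝ≥0∞ :=
  ⨆ t : ℝ≥0, (t : ℝ≥0∞) ^ p.toReal * μ {x | (t : ℝ≥0∞) < ‖f x‖ₑ}

/-- **Weak-`L^p` membership**, `f ∈ L^p_w(μ) = L^{p,∞}(μ)`: `f` is a.e.-strongly measurable and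
`sup_{t>0} t^p μ{|f| > t} < ∞` (Grafakos, Def. 1.1.5; Bradshaw–Tsai 2017, §1: the weak Lebesgue
space `L³_w(ℝ³) = L^{(3,∞)}(ℝ³)` of DSS initial data). [cite: BradshawTsai2017AHP, §1 (L^3_w = L^{(3,∞)})] -/
def MemWeakLp (f : α → E) (p : ℝ≥0∞) (μ : Measure α) : Prop :=
  AEStronglyMeasurable f μ ∧ eWeakLpPow f p μ < ∞

variable {f : α → E} {p : ℝ≥0∞} {μ : Measure α}

/-- Unfolding lemma for `MemWeakLp`. [folklore] -/
theorem memWeakLp_iff :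
    MemWeakLp f p μ ↔ AEStronglyMeasurable f μ ∧ eWeakLpPow f p μ < ∞ :=
  Iff.rfl

/-- A weak-`L^p` function is a.e.-strongly measurable (by definition). [folklore] -/
theorem MemWeakLp.aestronglyMeasurable (h : MemWeakLp f p μ) : AEStronglyMeasurable f μ :=
  h.1

/-- A weak-`L^p` function has finite weak quasinorm (by definition). [folklore] -/
theorem MemWeakLp.eWeakLpPow_lt_top (h : MemWeakLp f p μ) : eWeakLpPow f p μ < ∞ :=
  h.2

/-- Each level `t` is bounded by the supremum: `t^p μ{t < ‖f‖} ≤ eWeakLpPow f p μ`. [folklore] -/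
theorem rpow_mul_meas_lt_le_eWeakLpPow (f : α → E) (p : ℝ≥0∞) (μ : Measure α) (t : ℝ≥0) :
    (t : ℝ≥0∞) ^ p.toReal * μ {x | (t : ℝ≥0∞) < ‖f x‖ₑ} ≤ eWeakLpPow f p μ :=
  le_iSup (fun t : ℝ≥0 => (t : ℝ≥0∞) ^ p.toReal * μ {x | (t : ℝ≥0∞) < ‖f x‖ₑ}) t

/-- `eWeakLpPow f p μ ≤ C` iff every level is bounded by `C`. [folklore] -/
theorem eWeakLpPow_le_iff {C : ℝ≥0∞} :
    eWeakLpPow f p μ ≤ C ↔ ∀ t : ℝ≥0, (t : ℝ≥0∞) ^ p.toReal * μ {x | (t : ℝ≥0∞) < ‖f x‖ₑ} ≤ C :=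
  iSup_le_iff

/-- The zero function has zero weak quasinorm (all its superlevel sets `{t < ‖0‖}` are empty). [folklore] -/
@[simp]
theorem eWeakLpPow_zero : eWeakLpPow (0 : α → E) p μ = 0 := by
  simp [eWeakLpPow]

/-- `0 ∈ L^{p,∞}`. [folklore] -/
theorem memWeakLp_zero : MemWeakLp (0 : α → E) p μ :=
  ⟨aestronglyMeasurable_const, by simp⟩

/-- **Chebyshev's inequality**, weak form: `sup_t t^p μ{|f| > t} ≤ ‖f‖_{L^p}^p` for
`0 < p < ∞` (Grafakos, Prop. 1.1.6 / (1.1.8); from Mathlib's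
`MeasureTheory.mul_meas_ge_le_pow_eLpNorm'`). [folklore] -/
theorem eWeakLpPow_le_eLpNorm_rpow (hp0 : p ≠ 0) (hptop : p ≠ ∞)
    (hf : AEStronglyMeasurable f μ) : eWeakLpPow f p μ ≤ eLpNorm f p μ ^ p.toReal := by
  refine iSup_le fun t => ?_
  have hsub : {x | (t : ℝ≥0∞) < ‖f x‖ₑ} ⊆ {x | (t : ℝ≥0∞) ≤ ‖f x‖ₑ} :=
    fun x (hx : (t : ℝ≥0∞) < ‖f x‖ₑ) => hx.le
  calc (t : ℝ≥0∞) ^ p.toReal * μ {x | (t : ℝ≥0∞) < ‖f x‖ₑ}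
      ≤ (t : ℝ≥0∞) ^ p.toReal * μ {x | (t : ℝ≥0∞) ≤ ‖f x‖ₑ} :=
        mul_le_mul' le_rfl (measure_mono hsub)
    _ ≤ eLpNorm f p μ ^ p.toReal := mul_meas_ge_le_pow_eLpNorm' μ hp0 hptop hf _

/-- **`L^p ⊆ L^{p,∞}`** for `0 < p < ∞` (Grafakos, Prop. 1.1.6: "every `L^p` function is in weak
`L^p`", by Chebyshev's inequality). [folklore] -/
theorem memWeakLp_of_memLp (hp0 : p ≠ 0) (hptop : p ≠ ∞) (hf : MemLp f p μ) :
    MemWeakLp f p μ :=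
  ⟨hf.1, (eWeakLpPow_le_eLpNorm_rpow hp0 hptop hf.1).trans_lt
    (ENNReal.rpow_lt_top_of_nonneg ENNReal.toReal_nonneg hf.2.ne)⟩

end General

/-! ### Non-vacuity beyond `L^p`: `|x|⁻¹ ∈ L^{d,∞}` -/

section InvNorm

variable {E : Type*} [NormedAddCommGroup E]

/-- The superlevel sets of `x ↦ ‖x‖⁻¹` are punctured balls: for `0 < t`,
`{x | t < ‖x‖⁻¹} ⊆ B(0, t⁻¹)`. [folklore] -/
theorem setOf_lt_enorm_inv_norm_subset_ball {t : ℝ≥0} (ht : 0 < t) :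
    {x : E | (t : ℝ≥0∞) < ‖(‖x‖⁻¹ : ℝ)‖ₑ} ⊆ ball (0 : E) (t : ℝ)⁻¹ := by
  intro x hx
  rw [mem_setOf_eq, Real.enorm_eq_ofReal (inv_nonneg.2 (norm_nonneg x)),
    ← ENNReal.ofReal_coe_nnreal, ENNReal.ofReal_lt_ofReal_iff_of_nonneg (NNReal.coe_nonneg t)] at hx
  have hx0 : 0 < ‖x‖ := by
    rcases (norm_nonneg x).eq_or_lt with h | h
    · rw [← h, inv_zero] at hx
      exact absurd hx (not_lt.2 (NNReal.coe_nonneg t))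
    · exact h
  rw [mem_ball, dist_zero_right]
  exact (lt_inv_comm₀ (NNReal.coe_pos.2 ht) hx0).1 hx

variable [NormedSpace ℝ E] [FiniteDimensional ℝ E] [MeasurableSpace E] [BorelSpace E]

/-- **`|x|⁻¹ ∈ L^{d,∞}(E)`** for a `d`-dimensional real normed space `E` (`d ≥ 1`) with an
additive Haar measure `μ`: `t^d μ{‖x‖⁻¹ > t} ≤ t^d μ(B(0,t⁻¹)) = μ(B(0,1)) < ∞` (Grafakos,
Example 1.1.7 with `p = n`; for `E = ℝ³` this is the membership `|x|⁻¹ ∈ L³_w(ℝ³) ∖ L³(ℝ³)` of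
the model discretely self-similar datum, Bradshaw–Tsai 2017, §1). [folklore] -/
theorem memWeakLp_inv_norm (μ : Measure E) [μ.IsAddHaarMeasure] (hd : 0 < finrank ℝ E) :
    MemWeakLp (fun x : E => (‖x‖⁻¹ : ℝ)) (finrank ℝ E : ℝ≥0∞) μ := by
  refine ⟨(continuous_norm.measurable.inv).aestronglyMeasurable, ?_⟩
  refine lt_of_le_of_lt (eWeakLpPow_le_iff.2 fun t => ?_) (measure_ball_lt_top (μ := μ) (x := (0 : E)) (r := 1))
  have hdR : ((finrank ℝ E : ℝ≥0∞)).toReal = (finrank ℝ E : ℝ) := ENNReal.toReal_natCast _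
  rw [hdR, ENNReal.rpow_natCast]
  rcases eq_or_ne t 0 with rfl | ht0
  · rw [ENNReal.coe_zero, zero_pow hd.ne', zero_mul]
    exact bot_le
  · have ht : 0 < t := pos_iff_ne_zero.2 ht0
    have ht' : (0 : ℝ) < (t : ℝ)⁻¹ := inv_pos.2 (NNReal.coe_pos.2 ht)
    calc (t : ℝ≥0∞) ^ finrank ℝ E * μ {x : E | (t : ℝ≥0∞) < ‖(‖x‖⁻¹ : ℝ)‖ₑ}
        ≤ (t : ℝ≥0∞) ^ finrank ℝ E * μ (ball (0 : E) (t : ℝ)⁻¹) := by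
          gcongr
          exact setOf_lt_enorm_inv_norm_subset_ball ht
      _ = (t : ℝ≥0∞) ^ finrank ℝ E * (ENNReal.ofReal (((t : ℝ)⁻¹) ^ finrank ℝ E) * μ (ball 0 1)) := by
          rw [Measure.addHaar_ball_of_pos μ (0 : E) ht']
      _ = μ (ball 0 1) := by
          rw [← mul_assoc, ← ENNReal.ofReal_coe_nnreal, ← ENNReal.ofReal_pow (NNReal.coe_nonneg t),
            ← ENNReal.ofReal_mul (pow_nonneg (NNReal.coe_nonneg t) _), ← mul_pow,
            mul_inv_cancel₀ (NNReal.coe_pos.2 ht).ne', one_pow, ENNReal.ofReal_one, one_mul]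

end InvNorm

end Literature.Analysis.FunctionSpaces

end
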